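import Summits.KontsevichZagierPeriods.KontsevichZagierPeriods.Theorems.LinRedNormalFormArrangementNormalFormStubRebaseSimplePosOnePosQuadFrame1

/-!
# Stub `stub_rebaseSimplePosOnePos` (crux `ArrangementNormalForm`, line `janus-bands`) —
part `QuadChoice`: the generic direction and the small radius (`B = 2`)

`B = 2` corner calculus, towards the assembly (choices feeding part `QuadFrame1`).
* `RebasePos.exists_generic_q` — a rational `q` such that, in the frame `x' = X + (1 q; 0 1) x''`,
  two far silent factors depending on `x₂''` with distinct `x₂''`-letters have distinct letter
  CONSTANTS (finitely many `q` are bad: one per pair of non-proportional far factors);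
* `RebasePos.exists_small` — a rational `r > 0` with `Kᵢ r < cᵢ` for finitely many `cᵢ > 0`;
* `RebasePos.detQ_ne_zero_of_indep` — independent linear parts have non-zero determinant;
* `RebasePos.split_family` — splitting a finite family of rows by a decidable predicate.
Registered as `rebaseSimplePos_genericQ`.

References: M. Kontsevich, D. Zagier, *Periods* (2001), §1.2.
-/

noncomputable section

open Set MeasureTheory MvPolynomial
open Literature.NumberTheory.Transcendental Literature.ModelTheory.ExponentialFields

namespace Summit.KontsevichZagierPeriods.ArrangementNormalForm.JanusBands

namespace RebasePos

open SeparatePos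

section Choice

variable {m : ℕ}

/-- The entries of the first-frame factors. -/
theorem NLQ_eq (X : Fin 2 → ℚ) (q : ℚ) (L : Fin m → (Fin 2 → ℚ) × ℚ) (j : Fin m) :
    NLQ X q L j = (![(L j).1 0, (L j).1 0 * q + (L j).1 1], (L j).1 0 * X 0 + (L j).1 1 * X 1 + (L j).2) := by
  simp only [NLQ, normLQ, matQ, Matrix.of_apply, Matrix.cons_val', Matrix.cons_val_zero, Matrix.cons_val_one,
    Matrix.empty_val', Matrix.cons_val_fin_one, mul_one, mul_zero, add_zero]

/-- **A generic direction.** See the module docstring. -/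
theorem exists_generic_q (X : Fin 2 → ℚ) (L : Fin m → (Fin 2 → ℚ) × ℚ) :
    ∃ q : ℚ, ∀ j j', (NLQ X q L j).2 ≠ 0 → (NLQ X q L j').2 ≠ 0 → (NLQ X q L j).1 1 ≠ 0 → (NLQ X q L j').1 1 ≠ 0 →
      sepLamQ (NLQ X q L) j ≠ sepLamQ (NLQ X q L) j' → (sepLamQ (NLQ X q L) j).2 ≠ (sepLamQ (NLQ X q L) j').2 := by
  classical
  -- the constants `γⱼ = Lⱼ(X)` do not depend on `q`
  set γ : Fin m → ℚ := fun j => (L j).1 0 * X 0 + (L j).1 1 * X 1 + (L j).2 with hγ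
  set bad : Finset ℚ := (Finset.univ : Finset (Fin m × Fin m)).image
    (fun jj => (γ jj.2 * (L jj.1).1 1 - γ jj.1 * (L jj.2).1 1) / (γ jj.1 * (L jj.2).1 0 - γ jj.2 * (L jj.1).1 0)) with hbad
  obtain ⟨q, hq⟩ := Infinite.exists_notMem_finset bad
  refine ⟨q, fun j j' hγ1 hγ2 hβ1 hβ2 hne heq => hne ?_⟩
  rw [NLQ_eq] at hγ1 hγ2 hβ1 hβ2
  simp only [Matrix.cons_val_one, Matrix.cons_val_fin_one] at hβ1 hβ2
  change γ j ≠ 0 at hγ1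
  change γ j' ≠ 0 at hγ2
  have heq' : γ j / ((L j).1 0 * q + (L j).1 1) = γ j' / ((L j').1 0 * q + (L j').1 1) := by
    have h := heq
    simp only [sepLamQ, NLQ_eq, Matrix.cons_val_one, Matrix.cons_val_fin_one, neg_inj] at h
    exact h
  rw [div_eq_div_iff hβ1 hβ2] at heq'
  -- `q (γ a' − γ' a) = γ' b − γ b'`
  have key : q * (γ j * (L j').1 0 - γ j' * (L j).1 0) = γ j' * (L j).1 1 - γ j * (L j').1 1 := by linear_combination heq'
  by_cases hd : γ j * (L j').1 0 - γ j' * (L j).1 0 = 0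
  · -- proportional factors: equal letters
    rw [hd, mul_zero] at key
    have ha' : (L j').1 0 = γ j' / γ j * (L j).1 0 := by field_simp; linear_combination hd
    have hb' : (L j').1 1 = γ j' / γ j * (L j).1 1 := by field_simp; linear_combination key
    have hc : γ j' / γ j ≠ 0 := div_ne_zero hγ2 hγ1
    simp only [sepLamQ, NLQ_eq, Matrix.cons_val_zero, Matrix.cons_val_one]
    refine Prod.ext (funext fun i => ?_) ?_
    · fin_cases i
      · simp only [Fin.zero_eta, Matrix.cons_val_zero]
        rw [ha', hb']
        have : γ j' / γ j * (L j).1 0 * q + γ j' / γ j * (L j).1 1 = γ j' / γ j * ((L j).1 0 * q + (L j).1 1) := by ring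
        rw [this, neg_inj, div_eq_div_iff hβ1 (mul_ne_zero hc hβ1)]
        ring
      · rfl
    · change -(γ j / ((L j).1 0 * q + (L j).1 1)) = -(γ j' / ((L j').1 0 * q + (L j').1 1))
      rw [neg_inj, div_eq_div_iff hβ1 hβ2]
      exact heq'
  · -- otherwise `q` is the bad value of the pair
    exfalso
    refine hq (Finset.mem_image.mpr ⟨(j, j'), Finset.mem_univ _, ?_⟩)
    show (γ j' * (L j).1 1 - γ j * (L j').1 1) / (γ j * (L j').1 0 - γ j' * (L j).1 0) = q
    rw [div_eq_iff hd]
    linear_combination -key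

/-- **A small radius**: `Kᵢ r < cᵢ` for finitely many `cᵢ > 0`, `Kᵢ ≥ 0`. -/
theorem exists_small {ι : Type*} [Fintype ι] (K c : ι → ℚ) (hK : ∀ i, 0 ≤ K i) (hc : ∀ i, 0 < c i) :
    ∃ r : ℚ, 0 < r ∧ ∀ i, K i * r < c i := by
  have hS : 0 ≤ ∑ i, K i / c i := Finset.sum_nonneg fun i _ => div_nonneg (hK i) (hc i).le
  refine ⟨1 / (1 + ∑ i, K i / c i), by positivity, fun i => ?_⟩
  rw [mul_one_div, div_lt_iff₀ (by positivity)]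
  have hi : K i / c i ≤ ∑ i, K i / c i :=
    Finset.single_le_sum (f := fun i => K i / c i) (fun i _ => div_nonneg (hK i) (hc i).le) (Finset.mem_univ i)
  have : K i = c i * (K i / c i) := by rw [mul_div_assoc', mul_comm, mul_div_assoc, div_self (hc i).ne', mul_one]
  nlinarith [hc i, this]

/-- Independent linear parts have a non-zero determinant. -/
theorem detQ_ne_zero_of_indep (hF wF : (Fin 2 → ℚ) × ℚ) (hh : hF.1 ≠ 0) (hdep : ¬ ∃ c : ℚ, wF.1 = c • hF.1) :
    detQ hF wF ≠ 0 := by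
  intro hd
  rw [detQ] at hd
  apply hdep
  by_cases h0 : hF.1 0 = 0
  · have h1 : hF.1 1 ≠ 0 := fun h1 => hh (funext fun i => by fin_cases i <;> assumption)
    rw [h0, zero_mul, zero_sub, neg_eq_zero, mul_eq_zero] at hd
    refine ⟨wF.1 1 / hF.1 1, funext fun i => ?_⟩
    fin_cases i
    · simp [h0, hd.resolve_left h1]
    · simp [h1]
  · refine ⟨wF.1 0 / hF.1 0, funext fun i => ?_⟩
    fin_cases i
    · simp [h0]
    · simp only [Fin.mk_one, Pi.smul_apply, smul_eq_mul]
      field_simp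
      linear_combination hd

/-- Splitting a finite family by a decidable predicate. -/
theorem split_family {α : Type*} {k : ℕ} (p : α → Prop) [DecidablePred p] (f : Fin k → α) :
    ∃ (k₁ k₂ : ℕ) (g₁ : Fin k₁ → α) (g₂ : Fin k₂ → α), (∀ i, p (g₁ i)) ∧ (∀ i, ¬ p (g₂ i)) ∧
      ∀ Q : α → Prop, (∀ j, Q (f j)) ↔ ((∀ i, Q (g₁ i)) ∧ (∀ i, Q (g₂ i))) := by
  classical
  refine ⟨Fintype.card {j // p (f j)}, Fintype.card {j // ¬ p (f j)},
    fun i => f ((Fintype.equivFin {j // p (f j)}).symm i).1, fun i => f ((Fintype.equivFin {j // ¬ p (f j)}).symm i).1,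
    fun i => ((Fintype.equivFin {j // p (f j)}).symm i).2, fun i => ((Fintype.equivFin {j // ¬ p (f j)}).symm i).2,
    fun Q => ⟨fun h => ⟨fun i => h _, fun i => h _⟩, fun ⟨h1, h2⟩ j => ?_⟩⟩
  by_cases hj : p (f j)
  · have := h1 (Fintype.equivFin {j // p (f j)} ⟨j, hj⟩)
    simpa using this
  · have := h2 (Fintype.equivFin {j // ¬ p (f j)} ⟨j, hj⟩)
    simpa using this

end Choice

end RebasePos

/-- **Registered part of `stub_rebaseSimplePosOnePos` (line `janus-bands`, `B = 2` corner
calculus): a generic direction.** For finitely many affine forms over the silent plane and a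
rational point `X` there is a rational `q` such that in the frame `x' = X + (1 q; 0 1) x''` any two
far forms depending on `x₂''` with distinct `x₂''`-letters have distinct letter constants. -/
theorem rebaseSimplePos_genericQ (m : ℕ) (X : Fin 2 → ℚ) (L : Fin m → (Fin 2 → ℚ) × ℚ) : ∃ q : ℚ, ∀ j j', (RebasePos.NLQ X q L j).2 ≠ 0 → (RebasePos.NLQ X q L j').2 ≠ 0 → (RebasePos.NLQ X q L j).1 1 ≠ 0 → (RebasePos.NLQ X q L j').1 1 ≠ 0 → RebasePos.sepLamQ (RebasePos.NLQ X q L) j ≠ RebasePos.sepLamQ (RebasePos.NLQ X q L) j' → (RebasePos.sepLamQ (RebasePos.NLQ X q L) j).2 ≠ (RebasePos.sepLamQ (RebasePos.NLQ X q L) j').2 :=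
  RebasePos.exists_generic_q X L

end Summit.KontsevichZagierPeriods.ArrangementNormalForm.JanusBands
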